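import Literature.AnabelianGeometry.EtaleTheta.SettingModelChiTwist
import HarnessLib

/-!
# A model of the [EtTh] §1 root, χ-twisted reshape (R78 (B)): the procyclic `b`-axis `b^Ẑ ⊆ F̂₂`, `⊆ Γ`
# — the ingredient of a CUSP DATUM for `curveχ` (census consequence of INHABITATION-CENSUS-L2-v2)

Mochizuki, *The étale theta function …*, Publ. RIMS **45** (2009) [EtTh], §1, PRIMS PDF p. 12–13
[cite: MochizukiEtTh2009, §1 p.12]: "`Δ_X` … a profinite free group on 2 generators", "any decomposition group
of a cusp of `Y^log`" (p. 13); Mochizuki, *Semi-graphs of anabelioids* [SemiAnbd], Publ. RIMS **42** (2006), §6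
p. 71: "`I_x` is isomorphic to `Ẑ(1)` if `x` is a cusp" [cite: MochizukiSemiAnbd2006, §6 p.71] — the clause
`inertia_equiv_zHat` of abc-iut-L3-t2's `SemiGraphs.TemperedCurve`.

Cell abc-iut, layer L2, R78 cluster (χ-twisted root model, abc-iut-L2-lead RULINGS #13 R100/R130; this file =
row R130 «CUSP DATUM for curveχ», stage (S1), seat abc-iut-w5-d029, SHAPES STATUS 2026-08-26T06:38:55Z).
WHY (census): every model of `TemperedCurve p` built so far has `Pt := PEmpty` BY NECESSITY — a cusp needs a
closed subgroup of `Π^tp` meeting `Δ^tp` in a copy of `Ẑ`, impossible in a DISCRETE `Δ^tp`; abc-iut-w5-d249's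
F4 (`SettingModelChiSemidirect`, `Π^tp_X := Γ ⋊_χ G_{ℚ_p}`, `Γ = F̂₂ ×_Ẑ ℤ`) has a profinite factor, so a cusp
becomes possible.  This file supplies, over abc-iut-w5-d024's F2 (`SettingModelChiTwist`: `bPow : Ẑ → F̂₂`,
`t ↦ b^t`; `twist`, `twistGfp`), everything about the `b`-AXIS that the cusp clauses need, independently of
F4's carrier:

* §1 `expB`, **`eHatB : F̂₂ →ₜ* Ẑ`** (the completed `b`-exponent sum) with **`eHatB_bPow : eHatB (b^t) = t`**
  — a continuous RETRACTION of `bPow`; hence `bPow_injective`, `isClosedEmbedding_bPow`, the closed subgroup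
  **`bAxis = b^Ẑ`** and **`bAxisEquiv : ↥bAxis ≃ₜ* Ẑ`** (the clause `inertia_equiv_zHat` in the making), and the
  χ-STABILITY `map_twist_bAxis` (from F2's `twist_bPow : θ_φ(b^t) = b^{φ t}`);
* §2 the same inside `Γ`: **`bPowGfp : Ẑ →ₜ* Γ`**, `t ↦ (b^t, 0)` (legitimate because `ê(b^t) = 1`, F2), with
  `gfpSnd_bPowGfp = 1` (the axis lies in `Ker(Γ ↠ ℤ)` = the `Π^tp_Y` direction — clause (P3) of
  `OncePuncturedData`), `twistGfp_bPowGfp`, `bAxisGfp`, `isClosed_bAxisGfp`, `bAxisGfpEquiv : ↥bAxisGfp ≃ₜ* Ẑ`;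
* §3 the DECOMPOSITION SUBGROUP in any semidirect product `Γ ⋊[ρ] G` whose action stabilises the axis
  (F4's `PiTpχ p = Γ ⋊[twistGfp ∘ chi] G_{ℚ_p}` is the case `ρ := twistGfp.comp χ`): **`cuspDecomp ρ hρ :=
  {g | g.left ∈ bAxisGfp}`**, with `rightHom '' cuspDecomp = ⊤` (clause (P4)/`isOpen_aug_decomp`),
  `cuspDecomp ⊓ Ker rightHom = inl(bAxisGfp)` and, given the continuity of `left`/`inl` for the chosen
  topology (F4 (α) T1/T4), `isClosed_cuspDecomp` and **`inertiaEquiv : ↥(cuspDecomp ⊓ Ker rightHom) ≃ₜ* Ẑ`**.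
  Stage (S2) (after F4 lands) is then three lines: `Pt := Unit`, `IsCusp := ⊤`, `decomp := cuspDecomp`.

HONEST LABEL (integrator abc-iut-L6-d6, R78-MAP #3: «synthetic cusp datum — inertia := the Tate-twisted procyclic
axis b^Ẑ; in print the cusp of the once-punctured curve is the BOUNDARY COMMUTATOR axis ⁅a,b⁆^Ẑ, whose image generates
Δ_Θ; the commutator axis is NOT twist-stable on the nose in F̂₂ (θ_φ⁅a,b^t⁆ ≡ ⁅a,b⁆^{φt} only mod [[F̂₂,F̂₂],F̂₂]⁻,
`twist_cPow_mul_inv_mem_closure₃` of `SettingModelThetaCentreZHat`), so a split decomposition group D_x = axis ⋊ G_{ℚ_p}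
forces the b-axis»; and `ĥ_N(b^t) = (0, t, 0)` has `z = 0`: the b-axis maps TRIVIALLY to `Δ_Θ`).  The axis is the TORAL loop `b`: a χ-isotypic closed procyclic subgroup (`θ_φ` acts on it
through `φ`, i.e. it is «`≅ Ẑ(1)`» for the cyclotomic `ρ`), satisfying every TYPED cusp clause of
`TemperedCurve` and (P2)–(P4) of `OncePuncturedData`.  It is NOT print's cusp inertia, which is the COMMUTATOR
direction `⟨[a,b]⟩^Ẑ` (central in `Δ^Θ`, trivial in `Δ^ell`); in model (B) no `G_{ℚ_p}`-section normalises
`⟨[a,b]⟩^Ẑ` (the twist `a ↦ a, b ↦ b^u` does not preserve its conjugacy class), so a commutator-axis cusp is not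
available there.  Consequently clauses that READ `Π^tp_{Y_N}` off a cusp section (`Thm16Sub.GtpYNFromCusp`)
must not be fed this datum and stay «genuine-models-only»; the cusp-indexed RECORDS of the census
(IsThm16Origin's `exists_cuspidal_le_GtpY` shape, `DotCCusp`, `CuspidalPointDd`, `CuspidalTorsorData`,
`Cor28iiData`) become inhabitable.  Semi-synthetic model, consistency evidence only — not the tempered `π₁` of
a curve; [EtTh]/[SemiAnbd] are refereed; typed ≠ proved; no side taken on [IUTchIII] Cor. 3.12.  Post-freeze
class (b) CONSTRUCTION over the frozen interface (no interface clause touched, no instance, no Prop fact).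
-/

noncomputable section

namespace Literature.AnabelianGeometry.EtaleTheta.SettingModel

open Literature.AnabelianGeometry.SemiGraphs
open Literature.AnabelianGeometry.AbsoluteAnabelian
open CategoryTheory Function ProfiniteGrp ProfiniteGrp.ProfiniteCompletion Topology

/-! ## §1. The `b`-exponent sum and the retraction of `b^· : Ẑ → F̂₂` -/

/-- The `b`-exponent sum `F₂ → ℤ` (the `y`-coordinate of the Heisenberg image).
[cite: MochizukiEtTh2009, §1 p.12] -/
def expB : F₂ →* Multiplicative ℤ := Heis.yHom.comp heisHom

/-- [cite: MochizukiEtTh2009, §1 p.12] -/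
theorem expB_apply (g : F₂) : expB g = Multiplicative.ofAdd (heisHom g).y := rfl

/-- `expB b = 1 ∈ ℤ`. [cite: MochizukiEtTh2009, §1 p.12] -/
theorem expB_of_one : expB (FreeGroup.of 1) = Multiplicative.ofAdd 1 := by
  rw [expB_apply, heisHom_of_one]

/-- `expB a = 0 ∈ ℤ`. [cite: MochizukiEtTh2009, §1 p.12] -/
theorem expB_of_zero : expB (FreeGroup.of 0) = 1 := by
  rw [expB_apply, heisHom_of_zero]
  rfl

/-- **`ê_b : F̂₂ → Ẑ`**, the continuous extension of the `b`-exponent sum. [cite: MochizukiEtTh2009, §1 p.12] -/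
def eHatB : F₂hatT →ₜ* ZH :=
  (ProfiniteGrp.ProfiniteCompletion.lift (P := ZHat) (GrpCat.ofHom (iotaZ.comp expB))).hom

/-- `ê_b (η g) = ι (expB g)`. [cite: MochizukiEtTh2009, §1 p.12] -/
theorem eHatB_eta (g : F₂) : eHatB (eta g) = iotaZ (expB g) :=
  lift_hom_toCompletion ZHat (iotaZ.comp expB) g

/-- **`ê_b (b^t) = t`**: `ê_b` is a continuous retraction of `b^·` (two continuous homomorphisms `Ẑ → Ẑ`
agreeing on `ι 1`). [cite: MochizukiEtTh2009, §1 p.12] -/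
theorem eHatB_bPow (t : ZH) : eHatB (bPow t) = t := by
  have h := ZHatCompletion.monoidHom_ext_of_continuous
    (f₁ := eHatB.toMonoidHom.comp bPow.toMonoidHom) (f₂ := MonoidHom.id ZH)
    (eHatB.continuous.comp bPow.continuous) continuous_id (by
      change eHatB (bPow (iotaZ (Multiplicative.ofAdd 1))) = iotaZ (Multiplicative.ofAdd 1)
      rw [bPow_iotaZ_one, eHatB_eta, expB_of_one])
  exact DFunLike.congr_fun h t

/-- `ê_b (η a) = 1`. [cite: MochizukiEtTh2009, §1 p.12] -/
theorem eHatB_eta_of_zero : eHatB (eta (FreeGroup.of 0)) = 1 := by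
  rw [eHatB_eta, expB_of_zero, map_one]

/-- `b^· : Ẑ → F̂₂` is injective. [cite: MochizukiEtTh2009, §1 p.12] -/
theorem bPow_injective : Injective bPow :=
  (leftInverse_iff_comp.mpr (funext eHatB_bPow) : LeftInverse eHatB bPow).injective

/-- `b^· : Ẑ → F̂₂` is a closed embedding (continuous injective, compact source, Hausdorff target).
[cite: MochizukiEtTh2009, §1 p.12] -/
theorem isClosedEmbedding_bPow : _root_.Topology.IsClosedEmbedding bPow :=
  bPow.continuous.isClosedEmbedding bPow_injective

/-- **The `b`-axis `b^Ẑ ⊆ F̂₂`**, the closed procyclic subgroup topologically generated by `η b`.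
[cite: MochizukiEtTh2009, §1 p.12] -/
def bAxis : Subgroup F₂hatT := bPow.toMonoidHom.range

/-- [cite: MochizukiEtTh2009, §1 p.12] -/
theorem mem_bAxis_iff (x : F₂hatT) : x ∈ bAxis ↔ ∃ t, bPow t = x := Iff.rfl

/-- [cite: MochizukiEtTh2009, §1 p.12] -/
theorem bPow_mem_bAxis (t : ZH) : bPow t ∈ bAxis := ⟨t, rfl⟩

/-- `η b ∈ b^Ẑ`. [cite: MochizukiEtTh2009, §1 p.12] -/
theorem eta_of_one_mem_bAxis : eta (FreeGroup.of 1) ∈ bAxis := ⟨_, bPow_iotaZ_one⟩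

/-- `b^Ẑ` is closed in `F̂₂`. [cite: MochizukiSemiAnbd2006, §6 p.71] -/
theorem isClosed_bAxis : IsClosed (bAxis : Set F₂hatT) := by
  change IsClosed (Set.range bPow.toMonoidHom)
  exact isClosedEmbedding_bPow.isClosed_range

/-- `ê (x) = 1` on the `b`-axis (its `a`-exponent vanishes; F2's `eHat_bPow`). [cite: MochizukiEtTh2009, §1 p.12] -/
theorem eHat_eq_one_of_mem_bAxis {x : F₂hatT} (hx : x ∈ bAxis) : eHat x = 1 := by
  obtain ⟨t, rfl⟩ := hx
  exact eHat_bPow t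

/-- **`Ẑ ≃ₜ* b^Ẑ`**: `b^·` corestricted to its range, inverse `ê_b`. [cite: MochizukiSemiAnbd2006, §6 p.71] -/
def zHatEquivBAxis : ZH ≃ₜ* bAxis where
  toFun t := ⟨bPow t, bPow_mem_bAxis t⟩
  invFun x := eHatB x.1
  left_inv t := eHatB_bPow t
  right_inv x := by
    obtain ⟨_, t, rfl⟩ := x
    exact Subtype.ext (congrArg bPow (eHatB_bPow t))
  map_mul' s t := Subtype.ext (map_mul bPow s t)
  continuous_toFun := bPow.continuous.subtype_mk _
  continuous_invFun := eHatB.continuous.comp continuous_subtype_val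

/-- **`b^Ẑ ≃ₜ* Ẑ`** — the shape of the clause `inertia_equiv_zHat` ("`I_x ≅ Ẑ(1)`").
[cite: MochizukiSemiAnbd2006, §6 p.71] -/
def bAxisEquiv : bAxis ≃ₜ* ZHat := zHatEquivBAxis.symm

/-- [cite: MochizukiEtTh2009, §1 p.12] -/
@[simp] theorem zHatEquivBAxis_apply_coe (t : ZH) : ((zHatEquivBAxis t : bAxis) : F₂hatT) = bPow t := rfl

/-- **χ-stability of the axis**: every twist `θ_φ` (`a ↦ a`, `b ↦ b^{φ}`) maps `b^Ẑ` onto itself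
(`θ_φ (b^t) = b^{φ t}`). [cite: MochizukiEtTh2009, §1 p.12] -/
theorem map_twist_bAxis (φ : MulAut ZH) : bAxis.map (twist φ).toMulEquiv.toMonoidHom = bAxis := by
  ext x
  constructor
  · rintro ⟨_, ⟨t, rfl⟩, rfl⟩
    exact ⟨φ t, (twist_bPow φ t).symm⟩
  · rintro ⟨t, rfl⟩
    refine ⟨bPow (φ.symm t), bPow_mem_bAxis _, ?_⟩
    change twist φ (bPow (φ.symm t)) = bPow t
    rw [twist_bPow, MulEquiv.apply_symm_apply]

/-- Pointwise form: `θ_φ x ∈ b^Ẑ` for `x ∈ b^Ẑ`. [cite: MochizukiEtTh2009, §1 p.12] -/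
theorem twist_mem_bAxis (φ : MulAut ZH) {x : F₂hatT} (hx : x ∈ bAxis) : twist φ x ∈ bAxis := by
  obtain ⟨t, rfl⟩ := hx
  exact ⟨φ t, (twist_bPow φ t).symm⟩

/-! ## §2. The axis inside `Γ = F̂₂ ×_Ẑ ℤ` -/

/-- `(b^t, 0) ∈ Γ` (`ê(b^t) = 1 = ι 0`). [cite: MochizukiEtTh2009, §1 p.12] -/
theorem bPow_one_mem_Gfp (t : ZH) : ((bPow t, 1) : F₂hatT × Multiplicative ℤ) ∈ Gfp := by
  rw [mem_Gfp]
  change eHat (bPow t) = iotaZ 1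
  rw [eHat_bPow, map_one]

/-- **`b^· : Ẑ → Γ`**, `t ↦ (b^t, 0)`. [cite: MochizukiEtTh2009, §1 p.12] -/
def bPowGfp : ZH →ₜ* Gfp where
  toFun t := ⟨(bPow t, 1), bPow_one_mem_Gfp t⟩
  map_one' := Subtype.ext (Prod.ext (map_one bPow) rfl)
  map_mul' s t := Subtype.ext (Prod.ext (map_mul bPow s t) (one_mul _).symm)
  continuous_toFun := (bPow.continuous.prodMk continuous_const).subtype_mk _

/-- [cite: MochizukiEtTh2009, §1 p.12] -/
@[simp] theorem gfpFst_bPowGfp (t : ZH) : gfpFst (bPowGfp t) = bPow t := rfl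

/-- **The axis lies in `Ker(Γ ↠ ℤ)`** (the `Π^tp_Y` direction; clause (P3) "decomposition groups of cusps lie
in `Π^tp_Y`", [EtTh] p. 13). [cite: MochizukiEtTh2009, §1 p.13] -/
@[simp] theorem gfpSnd_bPowGfp (t : ZH) : gfpSnd (bPowGfp t) = 1 := rfl

/-- [cite: MochizukiEtTh2009, §1 p.12] -/
theorem coe_bPowGfp (t : ZH) : ((bPowGfp t : Gfp) : F₂hatT × Multiplicative ℤ) = (bPow t, 1) := rfl

/-- `b^· : Ẑ → Γ` is injective. [cite: MochizukiEtTh2009, §1 p.12] -/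
theorem bPowGfp_injective : Injective bPowGfp := fun s t h =>
  bPow_injective (by simpa using congrArg gfpFst h)

/-- `b^· : Ẑ → Γ` is a closed embedding. [cite: MochizukiSemiAnbd2006, §6 p.71] -/
theorem isClosedEmbedding_bPowGfp : _root_.Topology.IsClosedEmbedding bPowGfp :=
  bPowGfp.continuous.isClosedEmbedding bPowGfp_injective

/-- **χ-equivariance in `Γ`**: `twistGfp φ (b^t, 0) = (b^{φ t}, 0)`. [cite: MochizukiEtTh2009, §1 p.12] -/
theorem twistGfp_bPowGfp (φ : MulAut ZH) (t : ZH) : twistGfp φ (bPowGfp t) = bPowGfp (φ t) :=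
  Subtype.ext (Prod.ext (twist_bPow φ t) rfl)

/-- **The `b`-axis of `Γ`.** [cite: MochizukiEtTh2009, §1 p.12] -/
def bAxisGfp : Subgroup Gfp := bPowGfp.toMonoidHom.range

/-- [cite: MochizukiEtTh2009, §1 p.12] -/
theorem mem_bAxisGfp_iff (q : Gfp) : q ∈ bAxisGfp ↔ ∃ t, bPowGfp t = q := Iff.rfl

/-- [cite: MochizukiEtTh2009, §1 p.12] -/
theorem bPowGfp_mem_bAxisGfp (t : ZH) : bPowGfp t ∈ bAxisGfp := ⟨t, rfl⟩

/-- `b^Ẑ ⊆ Γ` is closed. [cite: MochizukiSemiAnbd2006, §6 p.71] -/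
theorem isClosed_bAxisGfp : IsClosed (bAxisGfp : Set Gfp) := by
  change IsClosed (Set.range bPowGfp.toMonoidHom)
  exact isClosedEmbedding_bPowGfp.isClosed_range

/-- `b^Ẑ ≤ Ker(Γ ↠ ℤ)`. [cite: MochizukiEtTh2009, §1 p.13] -/
theorem bAxisGfp_le_ker_gfpSnd : bAxisGfp ≤ gfpSnd.ker := by
  rintro _ ⟨t, rfl⟩
  exact gfpSnd_bPowGfp t

/-- `pr₁(b^Ẑ ⊆ Γ) = b^Ẑ ⊆ F̂₂`. [cite: MochizukiEtTh2009, §1 p.12] -/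
theorem map_gfpFst_bAxisGfp : bAxisGfp.map gfpFst.toMonoidHom = bAxis := by
  ext x
  constructor
  · rintro ⟨_, ⟨t, rfl⟩, rfl⟩
    exact ⟨t, rfl⟩
  · rintro ⟨t, rfl⟩
    exact ⟨bPowGfp t, ⟨t, rfl⟩, rfl⟩

/-- **χ-stability in `Γ`**: `twistGfp φ` maps the axis onto itself. [cite: MochizukiEtTh2009, §1 p.12] -/
theorem map_twistGfp_bAxisGfp (φ : MulAut ZH) : bAxisGfp.map (twistGfp φ).toMonoidHom = bAxisGfp := by
  ext q
  constructor
  · rintro ⟨_, ⟨t, rfl⟩, rfl⟩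
    exact ⟨φ t, (twistGfp_bPowGfp φ t).symm⟩
  · rintro ⟨t, rfl⟩
    refine ⟨bPowGfp (φ.symm t), bPowGfp_mem_bAxisGfp _, ?_⟩
    change twistGfp φ (bPowGfp (φ.symm t)) = bPowGfp t
    rw [twistGfp_bPowGfp, MulEquiv.apply_symm_apply]

/-- Pointwise form. [cite: MochizukiEtTh2009, §1 p.12] -/
theorem twistGfp_mem_bAxisGfp (φ : MulAut ZH) {q : Gfp} (hq : q ∈ bAxisGfp) : twistGfp φ q ∈ bAxisGfp := by
  obtain ⟨t, rfl⟩ := hq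
  exact ⟨φ t, (twistGfp_bPowGfp φ t).symm⟩

/-- **`Ẑ ≃ₜ* b^Ẑ ⊆ Γ`** (inverse `ê_b ∘ pr₁`). [cite: MochizukiSemiAnbd2006, §6 p.71] -/
def zHatEquivBAxisGfp : ZH ≃ₜ* bAxisGfp where
  toFun t := ⟨bPowGfp t, bPowGfp_mem_bAxisGfp t⟩
  invFun q := eHatB (gfpFst q.1)
  left_inv t := eHatB_bPow t
  right_inv q := by
    obtain ⟨_, t, rfl⟩ := q
    exact Subtype.ext (congrArg bPowGfp (eHatB_bPow t))
  map_mul' s t := Subtype.ext (map_mul bPowGfp s t)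
  continuous_toFun := bPowGfp.continuous.subtype_mk _
  continuous_invFun := eHatB.continuous.comp (gfpFst.continuous.comp continuous_subtype_val)

/-- **`b^Ẑ (⊆ Γ) ≃ₜ* Ẑ`.** [cite: MochizukiSemiAnbd2006, §6 p.71] -/
def bAxisGfpEquiv : bAxisGfp ≃ₜ* ZHat := zHatEquivBAxisGfp.symm

/-! ## §3. The cusp decomposition subgroup in `Γ ⋊[ρ] G` for an axis-stabilising action -/

section Decomp

variable {G : Type*} [Group G] (ρ : G →* MulAut Gfp)
  (hρ : ∀ (γ : G) {q : Gfp}, q ∈ bAxisGfp → ρ γ q ∈ bAxisGfp)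

/-- **The cusp decomposition subgroup** `D := b^Ẑ ⋊ G = {g | g.left ∈ b^Ẑ}` of `Γ ⋊[ρ] G`, a subgroup
because the action stabilises the axis (for F4's `Γ ⋊[twistGfp ∘ χ] G_{ℚ_p}`: `twistGfp_mem_bAxisGfp`).
[cite: MochizukiEtTh2009, §1 p.13] -/
def cuspDecomp : Subgroup (Gfp ⋊[ρ] G) where
  carrier := {g | g.left ∈ bAxisGfp}
  one_mem' := by
    change (1 : Gfp ⋊[ρ] G).left ∈ bAxisGfp
    rw [SemidirectProduct.one_left]
    exact one_mem _
  mul_mem' {g h} hg hh := by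
    change (g * h).left ∈ bAxisGfp
    rw [SemidirectProduct.mul_left]
    exact mul_mem hg (hρ _ hh)
  inv_mem' {g} hg := by
    change g⁻¹.left ∈ bAxisGfp
    rw [SemidirectProduct.inv_left]
    exact hρ _ (inv_mem hg)

/-- [cite: MochizukiEtTh2009, §1 p.13] -/
theorem mem_cuspDecomp_iff (g : Gfp ⋊[ρ] G) : g ∈ cuspDecomp ρ hρ ↔ g.left ∈ bAxisGfp := Iff.rfl

/-- `G ↪ D` by the canonical section: `inr γ ∈ D`. [cite: MochizukiEtTh2009, §1 p.13] -/
theorem inr_mem_cuspDecomp (γ : G) : (SemidirectProduct.inr γ : Gfp ⋊[ρ] G) ∈ cuspDecomp ρ hρ := by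
  rw [mem_cuspDecomp_iff, SemidirectProduct.left_inr]
  exact one_mem _

/-- `inl (b^t, 0) ∈ D`. [cite: MochizukiEtTh2009, §1 p.13] -/
theorem inl_mem_cuspDecomp {q : Gfp} (hq : q ∈ bAxisGfp) :
    (SemidirectProduct.inl q : Gfp ⋊[ρ] G) ∈ cuspDecomp ρ hρ := by
  rwa [mem_cuspDecomp_iff, SemidirectProduct.left_inl]

/-- **(P4) / `isOpen_aug_decomp`: `D` maps ONTO `G`** under the augmentation `rightHom`.
[cite: MochizukiEtTh2009, §1 p.13] -/
theorem map_rightHom_cuspDecomp : (cuspDecomp ρ hρ).map SemidirectProduct.rightHom = ⊤ := by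
  rw [eq_top_iff]
  intro γ _
  exact ⟨SemidirectProduct.inr γ, inr_mem_cuspDecomp ρ hρ γ, SemidirectProduct.rightHom_inr γ⟩

/-- The same as an image of sets. [cite: MochizukiEtTh2009, §1 p.13] -/
theorem rightHom_image_cuspDecomp :
    (SemidirectProduct.rightHom : Gfp ⋊[ρ] G → G) '' (cuspDecomp ρ hρ : Set (Gfp ⋊[ρ] G)) = Set.univ := by
  rw [Set.eq_univ_iff_forall]
  intro γ
  exact ⟨SemidirectProduct.inr γ, inr_mem_cuspDecomp ρ hρ γ, SemidirectProduct.rightHom_inr γ⟩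

/-- **The inertia subgroup** `I := D ∩ Ker(rightHom) = inl(b^Ẑ)`. [cite: MochizukiSemiAnbd2006, §6 p.71] -/
theorem cuspDecomp_inf_ker_rightHom :
    cuspDecomp ρ hρ ⊓ (SemidirectProduct.rightHom : Gfp ⋊[ρ] G →* G).ker =
      bAxisGfp.map (SemidirectProduct.inl : Gfp →* Gfp ⋊[ρ] G) := by
  ext g
  rw [Subgroup.mem_inf, mem_cuspDecomp_iff, MonoidHom.mem_ker, SemidirectProduct.rightHom_eq_right]
  constructor
  · rintro ⟨hl, hr⟩
    refine ⟨g.left, hl, ?_⟩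
    exact SemidirectProduct.ext (by simp) (by simpa using hr.symm)
  · rintro ⟨q, hq, rfl⟩
    exact ⟨by simpa using hq, by simp⟩

/-- **(P3): `D` lies in `Ker(Γ ⋊ G ↠ ℤ)`** for the degree `g ↦ gfpSnd g.left` (F4's `toZχ` is of this shape,
`toZ = pr₂` as in t1's `toZM₂`): `gfpSnd g.left = 1` on `D`. [cite: MochizukiEtTh2009, §1 p.13] -/
theorem gfpSnd_left_eq_one_of_mem_cuspDecomp {g : Gfp ⋊[ρ] G} (hg : g ∈ cuspDecomp ρ hρ) :
    gfpSnd g.left = 1 :=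
  bAxisGfp_le_ker_gfpSnd hg

variable [TopologicalSpace (Gfp ⋊[ρ] G)]

/-- **`isClosed_decomp`**: if `left : Γ ⋊ G → Γ` is continuous for the chosen topology (F4 (α) T1 for the
induced product topology), `D` is closed. [cite: MochizukiSemiAnbd2006, §6 p.71] -/
theorem isClosed_cuspDecomp (hleft : Continuous (SemidirectProduct.left : Gfp ⋊[ρ] G → Gfp)) :
    IsClosed (cuspDecomp ρ hρ : Set (Gfp ⋊[ρ] G)) :=
  isClosed_bAxisGfp.preimage hleft

/-- **`inertia_equiv_zHat`**: if `left` and `inl` are continuous (F4 (α) T1/T4), the inertia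
`D ∩ Ker(rightHom)` is isomorphic to `Ẑ` as a topological group. [cite: MochizukiSemiAnbd2006, §6 p.71] -/
def inertiaEquiv (hleft : Continuous (SemidirectProduct.left : Gfp ⋊[ρ] G → Gfp))
    (hinl : Continuous (SemidirectProduct.inl : Gfp → Gfp ⋊[ρ] G)) :
    ↥(cuspDecomp ρ hρ ⊓ (SemidirectProduct.rightHom : Gfp ⋊[ρ] G →* G).ker) ≃ₜ* ZHat :=
  let e : ZH ≃ₜ* ↥(cuspDecomp ρ hρ ⊓ (SemidirectProduct.rightHom : Gfp ⋊[ρ] G →* G).ker) :=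
    { toFun := fun t => ⟨SemidirectProduct.inl (bPowGfp t),
        Subgroup.mem_inf.mpr ⟨inl_mem_cuspDecomp ρ hρ (bPowGfp_mem_bAxisGfp t), by
          rw [MonoidHom.mem_ker, SemidirectProduct.rightHom_inl]⟩⟩
      invFun := fun g => eHatB (gfpFst g.1.left)
      left_inv := fun t => by
        change eHatB (gfpFst (SemidirectProduct.inl (bPowGfp t) : Gfp ⋊[ρ] G).left) = t
        rw [SemidirectProduct.left_inl, gfpFst_bPowGfp, eHatB_bPow]
      right_inv := fun g => by
        obtain ⟨g, hg⟩ := g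
        obtain ⟨hl, hr⟩ := Subgroup.mem_inf.mp hg
        obtain ⟨t, ht⟩ := hl
        rw [MonoidHom.mem_ker, SemidirectProduct.rightHom_eq_right] at hr
        apply Subtype.ext
        change SemidirectProduct.inl (bPowGfp (eHatB (gfpFst g.left))) = g
        rw [← ht]
        change SemidirectProduct.inl (bPowGfp (eHatB (gfpFst (bPowGfp t)))) = g
        rw [gfpFst_bPowGfp, eHatB_bPow]
        exact SemidirectProduct.ext (by simpa using ht) (by simpa using hr.symm)
      map_mul' := fun s t => Subtype.ext (by
        change SemidirectProduct.inl (bPowGfp (s * t)) =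
          SemidirectProduct.inl (bPowGfp s) * SemidirectProduct.inl (bPowGfp t)
        rw [map_mul, map_mul])
      continuous_toFun := (hinl.comp bPowGfp.continuous).subtype_mk _
      continuous_invFun := eHatB.continuous.comp (gfpFst.continuous.comp
        (hleft.comp continuous_subtype_val)) }
  e.symm

/-- Hence the clause `inertia_equiv_zHat` in its `Nonempty` form. [cite: MochizukiSemiAnbd2006, §6 p.71] -/
theorem nonempty_inertiaEquiv (hleft : Continuous (SemidirectProduct.left : Gfp ⋊[ρ] G → Gfp))
    (hinl : Continuous (SemidirectProduct.inl : Gfp → Gfp ⋊[ρ] G)) :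
    Nonempty (↥(cuspDecomp ρ hρ ⊓ (SemidirectProduct.rightHom : Gfp ⋊[ρ] G →* G).ker) ≃ₜ* ZHat) :=
  ⟨inertiaEquiv ρ hρ hleft hinl⟩

end Decomp

/-- The stabilisation hypothesis `hρ` holds for F4's action `ρ := twistGfp ∘ χ` for ANY character `χ`.
[cite: MochizukiEtTh2009, §1 p.12] -/
theorem twistGfp_comp_stabilises {G : Type*} [Group G] (χ : G →* MulAut ZH) (γ : G) {q : Gfp}
    (hq : q ∈ bAxisGfp) : (twistGfp.comp χ) γ q ∈ bAxisGfp :=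
  twistGfp_mem_bAxisGfp (χ γ) hq

end Literature.AnabelianGeometry.EtaleTheta.SettingModel

end
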